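import Literature.NumberTheory.Automorphic.CMTorusRegularAEPairwise     -- ★ Steinhaus bricks `measure_subgroup_eq_zero_of_not_mem_nhds ∕ _of_tendsto` (`CMTorusRegularAEPrelims` §1) + the `U(Φ₃)(L⁺_v)` instance kit
import Literature.NumberTheory.Rogawski1990.Ch12Sec5Inputs              -- ★ the §12.5 datum `Ch12Sec5.EllipticData` and the socket (C2) `EllCartanAE`
import Literature.NumberTheory.Rogawski1990.CMLocalAPacketMembers        -- ★ `Gqs L v = U(Φ₃)(L⁺_v)`
import HarnessLib

/-!
# F0 · P3c · line LH6 «StCharTS» — «CARTAN-NULL★» (datum road S9b′, hypothesis form): on a compact Cartan representative `T` of the §12.5 datum,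
# Haar-almost every `t ∈ T` is regular, as soon as the singular locus of `T` lies in finitely many NON-OPEN closed subgroups of `T`
# (the root kernels) [Rogawski1990, §12.5 p. 184; §3.6 pp. 28–31; HarishChandra1970, Lemma 42]

Cell `pub/hodgecm-mathlib`, crux H413 = `stmt-HodgeConjecture-24833` (lane `--supports …`), route HCCMUnconditional; seat F0P3-p04 (g17) on the DATUM ROAD of
LH6-p01 (g4) (`F0/P3b/LH6-p01/g4/PLAN-S9-CartanWeylMeasures.v1.LH6p01g4.md` f08a07a41a83168e, slice S9b′ dealt 2026-09-02T11:36:12Z).  THEOREMS ONLY (no definition ∕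
instance ∕ notation ∕ named fact ∕ `sorry`); ★-only imports.

WHAT.  The socket (C2) `EllCartanAE` of the (S-𝔇) organ `stub_EllipticPackage` (`Cruxes/H413/Lines/F0_P3c_StCharTSPaydown.lean`) is reduced by ★ S9a
`F0P3cStCharTSCartanFields.ellCartanAE_of_compact_centralizers` (LH6-p01 (g4)) to ONE per-torus input, the binder
`hnull : ∀ T ∈ 𝔇.cartanG, ∀ᵐ t : ↥T ∂(𝔇.μT T), IsRegularElt ((t : Gqs L v).val : GL (Fin 3) (UnitaryGroup.LocalRing L v))`
(«CARTAN-NULL»: the singular set `T ∖ T^{reg}` of an elliptic Cartan subgroup is `dγ`-null — the tacit measure theory of p. 184, «`⟨α₁, α₂⟩_e = Σ_T |Ω(T,G)|⁻¹ ∫_{Z\T} …`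
over the WHOLE tori», [HarishChandra1970, Lemma 42]).  This file DELIVERS that binder from structure hypotheses only:
* §1 (generic, any locally compact group `T` with an inner-regular Haar measure `μ`): a measurable subgroup that is NOT OPEN is `μ`-null (Steinhaus, ★
  `measure_subgroup_eq_zero_of_not_mem_nhds`: a subgroup which is a neighbourhood of `1` is open, Mathlib `Subgroup.isOpen_of_mem_nhds`); a countable ∕ finite union of
  such subgroups is null (`measure_iUnion_subgroup_eq_zero_of_not_isOpen`, `measure_biUnion_finset_subgroup_eq_zero_of_not_isOpen`); the a.e. form «a property
  whose failure set lies in such a union holds `μ`-a.e.» (`ae_of_not_imp_mem_subgroup`, `ae_of_not_imp_mem_finset_subgroup`); and the two ways print certifies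
  «not open»: a net `u → 1` frequently outside (`not_isOpen_of_tendsto`), a continuous character non-trivial near `1` (`not_isOpen_ker_of_tendsto`,
  `isClosed_ker_of_continuous`).
* §2 (the `U(3)` reading at any datum `𝔇 : EllipticData (Gqs L v) H'`): **`cartanNull_of_rootKernels`** — if every elliptic representative `T ∈ 𝔇.cartanG` is compact
  with `𝔇.μT T` a Haar measure on `T`, and its SINGULAR LOCUS `{t ∈ T | ¬ IsRegularElt t}` lies in finitely many closed NON-OPEN subgroups of `T` (print §3.6: the ROOT
  KERNELS `{t ∈ T | α(t) = 1}` of the roots `α` of `(T, G)`, closed of infinite index in the compact torus `T`), then `hnull` HOLDS; **`cartanNull_of_rootChars`** — the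
  same with the kernels presented as kernels of finitely many continuous characters `α : ↥T →* C` into a Hausdorff topological group, each moved by a sequence
  `u → 1` of `T` («`α ≠ 1` near `1`»); **`ellCartanAE_input_of_rootKernels`** — the conjunction handed to ★ S9a verbatim.
HONEST LABEL.  The per-`T` root data stay HYPOTHESES here (print [Rogawski1990 §3.6]); their in-house discharge at a concrete compact `T = Z(γ₀)` (eigen-characters of
the commutant over `K̄`, ★ `Literature.LinearAlgebra.Matrix.apply_eigenbasis_eq_smul_of_commute`, and Hilbert-90 elements `(1 + εa)·((1 + εa)†)⁻¹ → 1` of `T`) is the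
sequel.  HC_CM is proved only modulo the 7 printed citations (2 remaining named inputs: hLiu418 = `stmt-HodgeConjecture-24832`, h413 = `stmt-HodgeConjecture-24833`)
until rung 0 closes; this file closes no organ (count-neutral).

## References
* [Rogawski1990] J. D. Rogawski, *Automorphic Representations of Unitary Groups in Three Variables*, Ann. of Math. Stud. 123 (1990): §3.6 pp. 28–31 (Cartan
  subgroups of `U(3)`, their roots); §12.5 p. 182 (Weyl integration formula), p. 184 (`⟨ , ⟩_e` over the elliptic tori).
* [HarishChandra1970] Harish-Chandra (notes by G. van Dijk), *Harmonic Analysis on Reductive p-adic Groups*, LNM 162 (1970), Lemma 42 (the singular set is null).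
* [Folland1995] G. B. Folland, *A Course in Abstract Harmonic Analysis* (1995), Prop. 2.4 (Steinhaus).
-/

set_option autoImplicit false
-- the mandated namespace has the single-problem summit's repeated segment (`HodgeConjecture.HodgeConjecture`)
set_option linter.dupNamespace false

noncomputable section

open NumberField IsDedekindDomain MeasureTheory MeasureTheory.Measure Filter Topology
open scoped Matrix MatrixGroups
open Literature.NumberTheory.Rogawski1990 Literature.NumberTheory.Automorphic Literature.NumberTheory.Automorphic.UnitaryGroup
open Literature.NumberTheory.Rogawski1990.Ch12Sec5

namespace Summit.HodgeConjecture.HodgeConjecture.Cruxes.H413.F0P3cStCharTSCartanNull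

/-! ## §1 Generic: non-open subgroups of a locally compact group are Haar-null; finite unions; the a.e. form -/

section NotOpen

variable {T : Type*} [Group T] [TopologicalSpace T]

/-- A subgroup that is NOT open is not a neighbourhood of `1` (a subgroup which is a neighbourhood of one of its points is open, Mathlib
`Subgroup.isOpen_of_mem_nhds`). [cite: Folland1995, Prop. 2.4] -/
theorem not_mem_nhds_one_of_not_isOpen [SeparatelyContinuousMul T] (K : Subgroup T) (hK : ¬ IsOpen (K : Set T)) :
    (K : Set T) ∉ 𝓝 (1 : T) :=
  fun h => hK (K.isOpen_of_mem_nhds h)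

/-- **A subgroup avoided FREQUENTLY by a net `u → 1` is not open** (an open subgroup is a neighbourhood of `1`, which the net enters eventually).  Print's
certificate «`α(t_k) ≠ 1` for a sequence `t_k → 1` in `T`». [cite: Rogawski1990, §3.6 p. 28] -/
theorem not_isOpen_of_tendsto [SeparatelyContinuousMul T] (K : Subgroup T) {ι : Type*} {l : Filter ι} {u : ι → T}
    (hu : Tendsto u l (𝓝 1)) (huK : ∃ᶠ k in l, u k ∉ K) : ¬ IsOpen (K : Set T) := by
  intro hopen
  obtain ⟨k, hk1, hk2⟩ := (huK.and_eventually (hu.eventually_mem (hopen.mem_nhds K.one_mem))).exists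
  exact hk1 hk2

/-- The kernel of a continuous character into a Hausdorff (indeed `T₁`) group is a CLOSED subgroup. [cite: Rogawski1990, §3.6 p. 28] -/
theorem isClosed_ker_of_continuous [IsTopologicalGroup T] {C : Type*} [Group C] [TopologicalSpace C] [T1Space C] (α : T →* C) (hα : Continuous α) :
    IsClosed (α.ker : Set T) := by
  have : (α.ker : Set T) = α ⁻¹' {1} := by
    ext t
    simp only [SetLike.mem_coe, MonoidHom.mem_ker, Set.mem_preimage, Set.mem_singleton_iff]
  rw [this]
  exact isClosed_singleton.preimage hα

/-- **The kernel of a character moved by a sequence `u → 1` is not open**: if `α (u k) ≠ 1` frequently along a net `u → 1` of `T`, then `ker α` is not open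
(`not_isOpen_of_tendsto`).  This is how print certifies that a root kernel `{t ∈ T | α(t) = 1}` has infinite index in a compact torus. [cite: Rogawski1990, §3.6 p. 28] -/
theorem not_isOpen_ker_of_tendsto [SeparatelyContinuousMul T] {C : Type*} [Group C] (α : T →* C) {ι : Type*} {l : Filter ι} {u : ι → T}
    (hu : Tendsto u l (𝓝 1)) (hα : ∃ᶠ k in l, α (u k) ≠ 1) : ¬ IsOpen (α.ker : Set T) :=
  not_isOpen_of_tendsto α.ker hu (hα.mono fun _ hk hmem => hk (α.mem_ker.1 hmem))

end NotOpen

section Haar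

variable {T : Type*} [Group T] [TopologicalSpace T] [IsTopologicalGroup T] [LocallyCompactSpace T] [MeasurableSpace T] [BorelSpace T]
  (μ : Measure T) [μ.IsHaarMeasure] [μ.InnerRegular]

/-- **A measurable subgroup that is NOT OPEN is Haar-null** (Steinhaus: if `μ K > 0` then `K = K ∕ K` is a neighbourhood of `1`, hence `K` is open; ★
`measure_subgroup_eq_zero_of_not_mem_nhds`).  In a compact group «not open» ⟺ «closed of infinite index» for closed `K`. [cite: Folland1995, Prop. 2.4] -/
theorem measure_subgroup_eq_zero_of_not_isOpen (K : Subgroup T) (hKm : MeasurableSet (K : Set T)) (hK : ¬ IsOpen (K : Set T)) : μ K = 0 :=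
  measure_subgroup_eq_zero_of_not_mem_nhds μ K hKm (not_mem_nhds_one_of_not_isOpen K hK)

/-- A closed subgroup that is not open is Haar-null (`measure_subgroup_eq_zero_of_not_isOpen`; closed sets are Borel). [cite: Folland1995, Prop. 2.4] -/
theorem measure_subgroup_eq_zero_of_isClosed_of_not_isOpen (K : Subgroup T) (hKc : IsClosed (K : Set T)) (hK : ¬ IsOpen (K : Set T)) : μ K = 0 :=
  measure_subgroup_eq_zero_of_not_isOpen μ K hKc.measurableSet hK

/-- **A countable union of measurable non-open subgroups is Haar-null.** [cite: Folland1995, Prop. 2.4] [cite: HarishChandra1970, Lemma 42] -/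
theorem measure_iUnion_subgroup_eq_zero_of_not_isOpen {ι : Type*} [Countable ι] (K : ι → Subgroup T)
    (hKm : ∀ i, MeasurableSet (K i : Set T)) (hK : ∀ i, ¬ IsOpen (K i : Set T)) : μ (⋃ i, (K i : Set T)) = 0 :=
  measure_iUnion_null_iff.2 fun i => measure_subgroup_eq_zero_of_not_isOpen μ (K i) (hKm i) (hK i)

/-- **A finite union (over a `Finset`) of measurable non-open subgroups is Haar-null** — the shape of the root kernels of a torus. [cite: Folland1995, Prop. 2.4]
[cite: HarishChandra1970, Lemma 42] -/
theorem measure_biUnion_finset_subgroup_eq_zero_of_not_isOpen (s : Finset (Subgroup T))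
    (hKm : ∀ K ∈ s, MeasurableSet (K : Set T)) (hK : ∀ K ∈ s, ¬ IsOpen (K : Set T)) : μ (⋃ K ∈ s, (K : Set T)) = 0 :=
  (measure_biUnion_null_iff s.countable_toSet).2 fun K hKs => measure_subgroup_eq_zero_of_not_isOpen μ K (hKm K hKs) (hK K hKs)

/-- **The a.e. form**: a property whose FAILURE SET lies in a countable union of measurable non-open subgroups holds Haar-almost everywhere.
[cite: HarishChandra1970, Lemma 42] [cite: Folland1995, Prop. 2.4] -/
theorem ae_of_not_imp_mem_subgroup {ι : Type*} [Countable ι] (K : ι → Subgroup T)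
    (hKm : ∀ i, MeasurableSet (K i : Set T)) (hK : ∀ i, ¬ IsOpen (K i : Set T)) {P : T → Prop}
    (hP : ∀ t, ¬ P t → ∃ i, t ∈ K i) : ∀ᵐ t ∂μ, P t := by
  rw [ae_iff]
  refine measure_mono_null (fun t ht => ?_) (measure_iUnion_subgroup_eq_zero_of_not_isOpen μ K hKm hK)
  obtain ⟨i, hi⟩ := hP t ht
  exact Set.mem_iUnion.2 ⟨i, hi⟩

/-- **The a.e. form over a `Finset` of subgroups**: if every `t` failing `P` lies in some member of a finite family `s` of measurable non-open subgroups, then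
`P` holds Haar-almost everywhere. [cite: HarishChandra1970, Lemma 42] [cite: Folland1995, Prop. 2.4] -/
theorem ae_of_not_imp_mem_finset_subgroup (s : Finset (Subgroup T))
    (hKm : ∀ K ∈ s, MeasurableSet (K : Set T)) (hK : ∀ K ∈ s, ¬ IsOpen (K : Set T)) {P : T → Prop}
    (hP : ∀ t, ¬ P t → ∃ K ∈ s, t ∈ K) : ∀ᵐ t ∂μ, P t := by
  rw [ae_iff]
  refine measure_mono_null (fun t ht => ?_) (measure_biUnion_finset_subgroup_eq_zero_of_not_isOpen μ s hKm hK)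
  obtain ⟨K, hKs, htK⟩ := hP t ht
  exact Set.mem_biUnion hKs htK

/-- **The a.e. form with the «not open» certificates spelled as nets**: every member of the finite family is closed and avoided frequently by a net `u → 1`.
[cite: HarishChandra1970, Lemma 42] [cite: Rogawski1990, §3.6 p. 28] -/
theorem ae_of_not_imp_mem_finset_subgroup_of_tendsto (s : Finset (Subgroup T))
    (hKc : ∀ K ∈ s, IsClosed (K : Set T))
    (hu : ∀ K ∈ s, ∃ u : ℕ → T, Tendsto u atTop (𝓝 1) ∧ ∃ᶠ k in atTop, u k ∉ K) {P : T → Prop}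
    (hP : ∀ t, ¬ P t → ∃ K ∈ s, t ∈ K) : ∀ᵐ t ∂μ, P t :=
  ae_of_not_imp_mem_finset_subgroup μ s (fun K hK => (hKc K hK).measurableSet)
    (fun K hK => by obtain ⟨u, hu1, huK⟩ := hu K hK; exact not_isOpen_of_tendsto K hu1 huK) hP

end Haar

/-! ## §2 The `U(3)` reading: «CARTAN-NULL» on the compact Cartan representatives of a §12.5 datum, from the root kernels -/

section U3

variable (L : Type) [Field L] [NumberField L] [IsCMField L] (v : HeightOneSpectrum (𝓞 ↥(maximalRealSubfield L)))

/-- **The Haar measure of a compact subgroup `T ⊂ U(Φ₃)(L⁺_v)` is inner regular** (and `T` is a second-countable locally compact group): the instance kit the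
Steinhaus bricks consume, on the subtype `↥T` (closed in the locally compact, second countable, Hausdorff `U(Φ₃)(L⁺_v)`; pseudo-metrisable and σ-compact, so every
σ-finite Borel measure is inner regular). [cite: Folland1995, Prop. 2.4] -/
theorem innerRegular_of_isCompact_subgroup [MeasurableSpace (Gqs L v)] [BorelSpace (Gqs L v)] (T : Subgroup (Gqs L v))
    (hT : IsCompact (T : Set (Gqs L v))) (μT : Measure ↥T) [μT.IsHaarMeasure] :
    μT.InnerRegular ∧ LocallyCompactSpace ↥T := by
  haveI : CompactSpace ↥T := isCompact_iff_compactSpace.1 hT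
  haveI : LocallyCompactSpace ↥T := hT.isClosed.isClosedEmbedding_subtypeVal.locallyCompactSpace
  haveI : SecondCountableTopology ↥T := TopologicalSpace.Subtype.secondCountableTopology _
  haveI : SigmaCompactSpace ↥T := inferInstance
  haveI : RegularSpace ↥T := IsTopologicalGroup.regularSpace _
  haveI : T2Space ↥T := inferInstance
  haveI : T3Space ↥T := @instT3Space _ _ inferInstance inferInstance
  haveI : TopologicalSpace.PseudoMetrizableSpace ↥T := (TopologicalSpace.metrizableSpace_of_t3_secondCountable ↥T).toPseudoMetrizableSpace
  haveI : BorelSpace ↥T := Subtype.borelSpace _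
  haveI : SigmaFinite μT := inferInstance
  exact ⟨Measure.instInnerRegularOfPseudoMetrizableSpaceOfSigmaCompactSpaceOfBorelSpaceOfSigmaFinite μT, inferInstance⟩

/-- **Haar-a.e. regularity on ONE compact subgroup `T ⊂ U(Φ₃)(L⁺_v)` from its root kernels**: if the singular locus `{t ∈ T | ¬ IsRegularElt t}` lies in finitely many
closed NON-OPEN subgroups of `T`, then for every Haar measure `μT` on `T`, `μT`-a.e. `t ∈ T` is regular. [cite: Rogawski1990, §12.5 p. 184; §3.6 p. 28]
[cite: HarishChandra1970, Lemma 42] -/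
theorem ae_isRegularElt_of_rootKernels [MeasurableSpace (Gqs L v)] [BorelSpace (Gqs L v)] (T : Subgroup (Gqs L v))
    (hT : IsCompact (T : Set (Gqs L v))) (μT : Measure ↥T) [μT.IsHaarMeasure]
    (s : Finset (Subgroup ↥T)) (hs : ∀ K ∈ s, IsClosed (K : Set ↥T) ∧ ¬ IsOpen (K : Set ↥T))
    (hsing : ∀ t : ↥T, ¬ IsRegularElt ((t : Gqs L v).val : GL (Fin 3) (UnitaryGroup.LocalRing L v)) → ∃ K ∈ s, t ∈ K) :
    ∀ᵐ t : ↥T ∂μT, IsRegularElt ((t : Gqs L v).val : GL (Fin 3) (UnitaryGroup.LocalRing L v)) := by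
  haveI : BorelSpace ↥T := Subtype.borelSpace _
  obtain ⟨hreg, hlc⟩ := innerRegular_of_isCompact_subgroup L v T hT μT
  haveI := hreg
  haveI := hlc
  exact ae_of_not_imp_mem_finset_subgroup μT s (fun K hK => (hs K hK).1.measurableSet) (fun K hK => (hs K hK).2) hsing

/-- **«CARTAN-NULL★» (hypothesis form) — the `hnull` binder of ★ S9a `F0P3cStCharTSCartanFields.ellCartanAE_of_compact_centralizers`, DELIVERED from the root
kernels**: at any §12.5 datum `𝔇` on `(U(Φ₃)(L⁺_v), H)` whose elliptic Cartan representatives `T ∈ 𝔇.cartanG` are COMPACT, carry a Haar measure `𝔇.μT T`, and have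
their singular locus inside finitely many closed non-open subgroups of `T` (print: the kernels `{t ∈ T | α(t) = 1}` of the roots `α` of `T` in `G`, closed of infinite
index in the compact torus `T`, [Rogawski1990 §3.6]), Haar-almost every `t ∈ T` is regular, for every `T ∈ 𝔇.cartanG`. [cite: Rogawski1990, §12.5 p. 184; §3.6 pp. 28–31]
[cite: HarishChandra1970, Lemma 42] -/
theorem cartanNull_of_rootKernels
    [MeasurableSpace (Gqs L v)] [BorelSpace (Gqs L v)]
    [∀ γ : Gqs L v, MeasurableSpace (Gqs L v ⧸ Subgroup.centralizer ({γ} : Set (Gqs L v)))]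
    [MeasurableSpace (Gqs L v ⧸ Subgroup.center (Gqs L v))]
    {H' : Type} [Group H'] [TopologicalSpace H'] [IsTopologicalGroup H'] [MeasurableSpace H']
    (𝔇 : EllipticData (Gqs L v) H')
    (hHaar : ∀ T ∈ 𝔇.cartanG, (𝔇.μT T).IsHaarMeasure)
    (hcpt : ∀ T ∈ 𝔇.cartanG, IsCompact (T : Set (Gqs L v)))
    (hker : ∀ T ∈ 𝔇.cartanG, ∃ s : Finset (Subgroup ↥T), (∀ K ∈ s, IsClosed (K : Set ↥T) ∧ ¬ IsOpen (K : Set ↥T)) ∧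
      ∀ t : ↥T, ¬ IsRegularElt ((t : Gqs L v).val : GL (Fin 3) (UnitaryGroup.LocalRing L v)) → ∃ K ∈ s, t ∈ K) :
    ∀ T ∈ 𝔇.cartanG, ∀ᵐ t : ↥T ∂(𝔇.μT T), IsRegularElt ((t : Gqs L v).val : GL (Fin 3) (UnitaryGroup.LocalRing L v)) := by
  intro T hT
  haveI := hHaar T hT
  obtain ⟨s, hs, hsing⟩ := hker T hT
  exact ae_isRegularElt_of_rootKernels L v T (hcpt T hT) (𝔇.μT T) s hs hsing

/-- **«CARTAN-NULL★» with the root kernels presented by CHARACTERS**: for every `T ∈ 𝔇.cartanG` (compact, `𝔇.μT T` Haar) finitely many continuous characters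
`α i : ↥T →* C` into a Hausdorff topological group (print: the roots `α` of `(T, G)` with values in `K̄ˣ`, or any faithful reading of them) such that (i) a singular
`t ∈ T` is killed by some `α i` («two eigenvalues of `t` coincide», §3.6) and (ii) each `α i` is moved by a sequence `u → 1` of `T` («`α ≢ 1` near `1`», so the root
kernel has infinite index); then Haar-almost every `t ∈ T` is regular. [cite: Rogawski1990, §12.5 p. 184; §3.6 pp. 28–31] [cite: HarishChandra1970, Lemma 42] -/
theorem cartanNull_of_rootChars
    [MeasurableSpace (Gqs L v)] [BorelSpace (Gqs L v)]
    [∀ γ : Gqs L v, MeasurableSpace (Gqs L v ⧸ Subgroup.centralizer ({γ} : Set (Gqs L v)))]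
    [MeasurableSpace (Gqs L v ⧸ Subgroup.center (Gqs L v))]
    {H' : Type} [Group H'] [TopologicalSpace H'] [IsTopologicalGroup H'] [MeasurableSpace H']
    (𝔇 : EllipticData (Gqs L v) H')
    {C : Type*} [Group C] [TopologicalSpace C] [T1Space C]
    (hHaar : ∀ T ∈ 𝔇.cartanG, (𝔇.μT T).IsHaarMeasure)
    (hcpt : ∀ T ∈ 𝔇.cartanG, IsCompact (T : Set (Gqs L v)))
    (hroot : ∀ T ∈ 𝔇.cartanG, ∃ (n : ℕ) (α : Fin n → (↥T →* C)),
      (∀ i, Continuous (α i)) ∧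
      (∀ i, ∃ u : ℕ → ↥T, Tendsto u atTop (𝓝 1) ∧ ∃ᶠ k in atTop, α i (u k) ≠ 1) ∧
      ∀ t : ↥T, ¬ IsRegularElt ((t : Gqs L v).val : GL (Fin 3) (UnitaryGroup.LocalRing L v)) → ∃ i, α i t = 1) :
    ∀ T ∈ 𝔇.cartanG, ∀ᵐ t : ↥T ∂(𝔇.μT T), IsRegularElt ((t : Gqs L v).val : GL (Fin 3) (UnitaryGroup.LocalRing L v)) := by
  classical
  refine cartanNull_of_rootKernels L v 𝔇 hHaar hcpt fun T hT => ?_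
  obtain ⟨n, α, hαc, hαu, hαs⟩ := hroot T hT
  refine ⟨Finset.univ.image fun i => (α i).ker, fun K hK => ?_, fun t ht => ?_⟩
  · obtain ⟨i, -, rfl⟩ := Finset.mem_image.1 hK
    obtain ⟨u, hu1, hui⟩ := hαu i
    exact ⟨isClosed_ker_of_continuous (α i) (hαc i), not_isOpen_ker_of_tendsto (α i) hu1 hui⟩
  · obtain ⟨i, hi⟩ := hαs t ht
    exact ⟨(α i).ker, Finset.mem_image.2 ⟨i, Finset.mem_univ i, rfl⟩, (α i).mem_ker.2 hi⟩

/-- **The (C2) hand-off**: under the hypotheses of `cartanNull_of_rootKernels`, the pair of per-torus inputs of ★ S9a `ellCartanAE_of_null` ∕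
`ellCartanAE_of_compact_centralizers` — «a.e. regular» (this file) and «regular ⇒ in `G^e`» (S9a's «ELL-CARTAN-AVOIDS-Ω», taken here as the hypothesis `havoid`) —
gives the socket (C2) `𝔇.EllCartanAE` of (S-𝔇). [cite: Rogawski1990, §12.5 p. 184] [cite: HarishChandra1970, Lemma 42] -/
theorem ellCartanAE_of_rootKernels
    [MeasurableSpace (Gqs L v)] [BorelSpace (Gqs L v)]
    [∀ γ : Gqs L v, MeasurableSpace (Gqs L v ⧸ Subgroup.centralizer ({γ} : Set (Gqs L v)))]
    [MeasurableSpace (Gqs L v ⧸ Subgroup.center (Gqs L v))]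
    {H' : Type} [Group H'] [TopologicalSpace H'] [IsTopologicalGroup H'] [MeasurableSpace H']
    (𝔇 : EllipticData (Gqs L v) H')
    (hHaar : ∀ T ∈ 𝔇.cartanG, (𝔇.μT T).IsHaarMeasure)
    (hcpt : ∀ T ∈ 𝔇.cartanG, IsCompact (T : Set (Gqs L v)))
    (hker : ∀ T ∈ 𝔇.cartanG, ∃ s : Finset (Subgroup ↥T), (∀ K ∈ s, IsClosed (K : Set ↥T) ∧ ¬ IsOpen (K : Set ↥T)) ∧
      ∀ t : ↥T, ¬ IsRegularElt ((t : Gqs L v).val : GL (Fin 3) (UnitaryGroup.LocalRing L v)) → ∃ K ∈ s, t ∈ K)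
    (havoid : ∀ T ∈ 𝔇.cartanG, ∀ t : ↥T, IsRegularElt ((t : Gqs L v).val : GL (Fin 3) (UnitaryGroup.LocalRing L v)) → (t : Gqs L v) ∈ 𝔇.ellG) :
    𝔇.EllCartanAE := by
  intro T hT
  filter_upwards [cartanNull_of_rootKernels L v 𝔇 hHaar hcpt hker T hT] with t ht
  exact havoid T hT t ht

end U3

end Summit.HodgeConjecture.HodgeConjecture.Cruxes.H413.F0P3cStCharTSCartanNull

end
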